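import Summits.BirchSwinnertonDyer.BirchSwinnertonDyer.Theorems.AdditiveKolyvaginRoadIstarIsogenyInvariance
import Summits.BirchSwinnertonDyer.Rank1Residual.Additive.GordKodairaType
import Summits.BirchSwinnertonDyer.Rank1Residual.Additive.GordIsogenyInvarianceClasses
import Summits.BirchSwinnertonDyer.Rank1Residual.AdditivePotMult.PStarTwistModel
import Summits.BirchSwinnertonDyer.Rank1Residual.Additive.GordTwistMinimalModel
import Summits.BirchSwinnertonDyer.Rank1Residual.X2.IsogenyClassStability
import Summits.BirchSwinnertonDyer.Rank1Residual.X12.CMIsogenyInvariance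
import Summits.BirchSwinnertonDyer.Rank1Residual.X11b.BDPRouteManin
import Literature.NumberTheory.EllipticCurves.NeronLocalHeightCompletion
import Literature.NumberTheory.EllipticCurves.IsogenyIdProofs
import Literature.NumberTheory.EllipticCurves.IsogenyPotentiallyGoodMinimalDiscriminant
import HarnessLib

/-!
# The K★ cell data pass to every member of the isogeny class (route `EdixhovenFibreFiveSeven`, crux K★
# stmt-BirchSwinnertonDyer-22226, line `kato-lever`; seat `bsd-line-edix-p1` g29, LEAD)

HONEST FRAMING. TOOL theorems only (no definition, no named fact, no instance, no `sorry`); ROUTE-INDEPENDENT imports (no `Theses` file in the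
cone — the G57 glue `…MemberManinUnitFiveSevenGlue` proves the same steps but imports the route file); nothing is closed; BSD / K★ are NOT proved.
CONDITIONAL on the cite-only fact Dokchitser–Dokchitser 2015 Thm. 5.1 (1) (`hDD`, displayed as a hypothesis; already a conjunct of this route's
`PublishedManinFacts` / `KPTransportInputs`).

WHY. The K★ cells are cut out by `Addv W p`, `Irr W p`, «no `Iₙ*` fibre at `p`», `4 < ord_p Δ_min(W)` and the selector
`p = 5 ↔ ord_p Δ_min = 9`; Kato's member `W′ ∼ W` of P1-bar is only known up to isogeny. This file moves ALL the cell data to `W′`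
(the pattern of `MemberManinUnitFiveSevenGlue.exists_member_not_dvd_c_of_four_lt`): `Addv` by `X2.addv_iff_of_isIsogenous`, `Irr` by
`X12.irr_iff_of_isIsogenous`, no `Iₙ*` by `IstarIsogenyInvariance.exists_kodairaSymbolAt_eq_Istar_of_isIsogenous`, and `ord_p Δ_min` by DD along a
cyclic isogeny (`IsIsogenous.exists_isCyclic`) of degree prime to `p` (`X11b.not_dvd_degree_of_isCyclic_of_irr`), whose potential-good-reduction
input `0 ≤ ord_p j` is §1 (no `Iₙ*` at an odd additive prime ⟹ `0 ≤ ord_p j`; private copy of the G57 lemma to stay out of the theses cone).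

* ★ `cellData_of_isIsogenous` — `Addv W′ p ∧ Irr W′ p ∧ (no Iₙ* for W′) ∧ ord_p Δ_min(W) = ord_p Δ_min(W′)`.
Consumer: `…CellsOfRecTowerAtIntrinsic` (K★ ⟸ intrinsic [REC-tower] stubs + DD + P1-bar).

References: [DokchitserDokchitser2015LocalInvariants] Thm. 5.1 (1); [SilvermanATAEC1994] IV.9.4 Steps 6–7, Table 4.1; [SilvermanAEC2009] VII.5.
-/

set_option autoImplicit false
-- the Theorems namespace of a single-conjunct summit repeats the summit name by design (D-0017)
set_option linter.dupNamespace false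

noncomputable section

open scoped Classical NumberField
open WeierstrassCurve NumberField Literature.NumberTheory.EllipticCurves
  Literature.NumberTheory.EllipticCurves.Rank1Residual
  Literature.NumberTheory.DiophantineGeometry IsDedekindDomain Rat.HeightOneSpectrum
  Summit.BirchSwinnertonDyer.Rank1Residual Summit.BirchSwinnertonDyer.Rank1Residual.Additive
  Summit.BirchSwinnertonDyer.BirchSwinnertonDyer.Theorems

namespace Summit.BirchSwinnertonDyer.BirchSwinnertonDyer.Theorems.StarredOptimalManinUnitFiveSevenCellDataOfIsogenous

variable {p : ℕ} [hp : Fact p.Prime]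

/-! ### §1 No `Iₙ*` fibre at an odd additive prime ⟹ `0 ≤ ord_p j` (private copy of the G57 lemma) -/

/-- The generator of the place of `ℤ` under `p` is `p`. [folklore] -/
private theorem natGenerator_placeOf : natGenerator (placeOf p) = p :=
  congrArg Subtype.val ((primesEquiv (R := ℤ)).apply_symm_apply ⟨p, hp.out⟩)

/-- **No `Iₙ*` fibre at an odd additive prime ⟹ potentially good (`0 ≤ ord_p j`)** (private copy of
`MemberManinUnitFiveSevenGlue.padicValRat_j_nonneg_of_forall_ne_Istar`, whose module imports the route file): if `ord_p j < 0` the additive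
`W` is the `p*`-twist of a curve multiplicative at `p`, hence of Kodaira type `Iₙ*` at `p` (Tate's algorithm Steps 6–7) — excluded.
[cite: SilvermanATAEC1994, IV.9.4 Steps 6–7 (PDF pp. 345–346) and Table 4.1] -/
private theorem padicValRat_j_nonneg_of_forall_ne_Istar (W : WeierstrassCurve ℚ) [W.IsElliptic]
    [W.IsGloballyMinimal] (hp2 : p ≠ 2) (hadd : Addv W p)
    (hK : ∀ (v : HeightOneSpectrum ℤ) (n : ℕ), natGenerator v = p →
      W.kodairaSymbolAt v ≠ KodairaSymbol.Istar n) :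
    0 ≤ padicValRat p W.j := by
  by_contra hj
  push Not at hj
  obtain ⟨V, iV, iVm, C, hmV, hW⟩ :=
    AdditivePotMult.PotMult.exists_mult_pStar_twist_model (W := W) (p := p) ⟨hadd, hj⟩ hp2
  set u : HeightOneSpectrum (𝓞 ℚ) := (primesEquiv (R := 𝓞 ℚ)).symm ⟨p, hp.out⟩ with hudef
  have hu : (primesEquiv u : ℕ) = p := by rw [hudef, Equiv.apply_symm_apply]
  have hu2 : (primesEquiv u : ℕ) ≠ 2 := by rw [hu]; exact hp2
  -- `V` is multiplicative at the place `u`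
  have hmult : V.HasMultiplicativeReductionAt u := by
    have key := V.hasMultiplicativeReductionAtPrime_iff_hasMultiplicativeReductionAt_ringOfIntegers u
    revert key
    generalize primesEquiv u = q at hu ⊢
    obtain ⟨q, hq⟩ := q
    cases hu
    intro key
    exact key.mp hmV
  -- `p*` as an integer, exactly divisible by `p`
  obtain ⟨hD0, h1, h2⟩ := IstarIsogenyInvariance.pStar_dvd_facts hp.out
  have hW' : C • V.quadraticTwist ((((-1 : ℤ) ^ (p / 2) * p : ℤ)) : ℚ) = W := by
    rw [(pStar_intCast p).1]; exact hW
  obtain ⟨n, hn⟩ := kodairaSymbolAt_twist_of_semistable u V hu2 (D := (-1 : ℤ) ^ (p / 2) * p) hD0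
    (by rw [hu]; exact h1) (by rw [hu]; exact h2) (Or.inr hmult) C hW'
  -- read at the place of `ℤ` under `p`
  have hvu : primesEquiv (placeOf p) = primesEquiv u := by
    rw [hudef, Equiv.apply_symm_apply]; exact (primesEquiv (R := ℤ)).apply_symm_apply ⟨p, hp.out⟩
  have hK' : W.kodairaSymbolAt (placeOf p) = .Istar n := by
    rw [O5.FlexNormalForm.kodairaSymbolAt_eq_of_primesEquiv_eq' W (placeOf p) u hvu]; exact hn
  exact hK (placeOf p) n natGenerator_placeOf hK'

/-! ### §2 The cell data along the isogeny class -/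

/-- ★ **The K★ cell data pass to every member of the class** (GRANTED Dokchitser–Dokchitser Thm. 5.1 (1)): for `W ∼ W′` globally minimal
over `ℚ`, `p ∈ {5, 7}`, `W` additive at `p` with `E[p]` irreducible and no `Iₙ*` fibre at `p`: `W′` is additive at `p`, `W′[p]` is irreducible,
`W′` has no `Iₙ*` fibre at `p`, and `ord_p Δ_min(W) = ord_p Δ_min(W′)` — so `4 < ord_p Δ_min` and the ordinary/supersingular selector pass too.
(`Addv`: `X2.addv_iff_of_isIsogenous`; `Irr`: `X12.irr_iff_of_isIsogenous`; `Iₙ*`: `IstarIsogenyInvariance.exists_kodairaSymbolAt_eq_Istar_of_isIsogenous`;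
`ord_p Δ_min`: DD along a cyclic isogeny of degree prime to `p`, `X11b.not_dvd_degree_of_isCyclic_of_irr`, with `0 ≤ ord_p j` from §1.)
[cite: DokchitserDokchitser2015LocalInvariants, Thm. 5.1 (1)] [cite: SilvermanATAEC1994, IV.9.4 Steps 6–7] -/
theorem cellData_of_isIsogenous
    (hDD : dokchitser_padicValInt_minimalDiscriminantInt_eq_of_isogeny_of_not_dvd_degree)
    {W W' : WeierstrassCurve ℚ} [W.IsElliptic] [W.IsGloballyMinimal] [W'.IsElliptic] [W'.IsGloballyMinimal]
    (hiso : IsIsogenous W W') (hp57 : p = 5 ∨ p = 7) (hadd : Addv W p) (hirr : Irr W p)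
    (hIstar : ∀ (v : HeightOneSpectrum ℤ) (n : ℕ), natGenerator v = p → W.kodairaSymbolAt v ≠ KodairaSymbol.Istar n) :
    Addv W' p ∧ Irr W' p ∧
      (∀ (v : HeightOneSpectrum ℤ) (n : ℕ), natGenerator v = p → W'.kodairaSymbolAt v ≠ KodairaSymbol.Istar n) ∧
      padicValInt p W.minimalDiscriminantInt = padicValInt p W'.minimalDiscriminantInt := by
  have hp2 : p ≠ 2 := by rcases hp57 with rfl | rfl <;> decide
  have hadd' : Addv W' p := (X2.addv_iff_of_isIsogenous (p := p) hiso).mp hadd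
  have hirr' : Irr W' p := (X12.irr_iff_of_isIsogenous hiso p).mp hirr
  have hIstar' : ∀ (v : HeightOneSpectrum ℤ) (n : ℕ), natGenerator v = p →
      W'.kodairaSymbolAt v ≠ KodairaSymbol.Istar n := by
    intro v n hv hK'
    obtain ⟨m, hm⟩ :=
      IstarIsogenyInvariance.exists_kodairaSymbolAt_eq_Istar_of_isIsogenous hiso.symm_of_charZero hp2 v hv hK'
    exact hIstar v m hv hm
  have hj : 0 ≤ padicValRat p W.j := padicValRat_j_nonneg_of_forall_ne_Istar W hp2 hadd hIstar
  obtain ⟨ψ, hψ⟩ := hiso.exists_isCyclic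
  have hdeg : ¬ p ∣ ψ.degree := X11b.not_dvd_degree_of_isCyclic_of_irr ψ hψ hp.out hirr
  exact ⟨hadd', hirr', hIstar', hDD W W' ψ p hp.out hdeg hj⟩

end Summit.BirchSwinnertonDyer.BirchSwinnertonDyer.Theorems.StarredOptimalManinUnitFiveSevenCellDataOfIsogenous

end
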